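import Summits.Ventures.QEC.Census.KernelReplayFast
import HarnessLib

/-!
# Soundness of the fast kernel RUP replayer (`Census/KernelReplayFast.lean`)

Cell `qec`, PARTITION row type-11 (K2 half of the certificate checker, LRAT hook, KERNEL tier).
`KRupFast.checkAll` / `kernelRupFast` replay RUP refutations of `Std.Sat.CNF ℕ` with clause bit-masks
(definitions and unfolding equations in `KernelReplayFast.lean`).  Here: the semantics (`MaskSat`,
`Cons`), the store invariant `Store.All` (every nonzero stored mask is a clause true under `σ` — the
proof never uses the trie's indexing), SOUNDNESS of `rup` and `checkAll` (`checkAll_sound`: every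
checked clause is true under `σ` and the advanced store keeps the invariant), the CHAIN lemmas for LRAT
proofs split over several modules (`all_advance_of_checkAll`, `false_of_checkAll_of_hasEmpty`,
`all_ofClauses_cnf`), the end-to-end `unsat_of_kernelRupFast`, and a kernel-checked 3-variable
control.  The only arithmetic input is Lean core's `Nat.and_sub_one_eq_zero_iff_isPowerOfTwo`
(a nonzero `x` with `x &&& (x-1) = 0` is a power of two) plus the bit lemmas of the companion file.
-/

namespace Summit.Ventures.QEC.Census.KRupFast

open Std.Sat Summit.Ventures.DiscreteObjects.UnitDistance

/-! ## Semantics and the store invariant -/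

/-- A clause mask is true under `σ`: some set bit is a true literal. -/
def MaskSat (σ : ℕ → Bool) (D : ℕ) : Prop := ∃ l, D.testBit l = true ∧ KRup.litTrue σ l = true

/-- The falsified-literal mask `F` is consistent with `σ`: every recorded literal is false. -/
def Cons (σ : ℕ → Bool) (F : ℕ) : Prop := ∀ l, F.testBit l = true → KRup.litTrue σ l = false

/-- Mask truth = `KRup` clause truth. -/
theorem maskSat_maskOf_iff (σ : ℕ → Bool) (C : List ℕ) : MaskSat σ (maskOf C) ↔ KRup.clauseTrue σ C = true := by
  unfold MaskSat KRup.clauseTrue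
  rw [List.any_eq_true]
  constructor
  · rintro ⟨l, hl, ht⟩
    exact ⟨l, (testBit_maskOf C l).1 hl, ht⟩
  · rintro ⟨l, hl, ht⟩
    exact ⟨l, (testBit_maskOf C l).2 hl, ht⟩

/-- The empty mask is never true. -/
theorem not_maskSat_zero (σ : ℕ → Bool) : ¬ MaskSat σ 0 := by
  rintro ⟨l, hl, -⟩
  simp at hl

/-- Every NONZERO value held in the trie satisfies `P`. -/
def Store.All (P : ℕ → Prop) : Store → Prop
  | .nil => True
  | .node l v r => l.All P ∧ (v = 0 ∨ P v) ∧ r.All P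

/-- A nonzero fetched mask satisfies the invariant. -/
theorem Store.All.get {P : ℕ → Prop} : ∀ {t : Store}, t.All P → ∀ (k : ℕ), t.get k = 0 ∨ P (t.get k)
  | .nil, _, k => Or.inl (get_nil k)
  | .node l v r, ⟨hl, hv, hr⟩, k => by
      rw [get_node]
      cases Nat.ble k 1
      · cases Nat.beq (Nat.mod k 2) 0
        · exact Store.All.get hr _
        · exact Store.All.get hl _
      · exact hv

/-- The empty store satisfies every invariant. -/
theorem Store.All_nil (P : ℕ → Prop) : Store.All P .nil := trivial

/-- Inserting a mask satisfying `P` preserves the invariant. -/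
theorem Store.All.ins {P : ℕ → Prop} {C : ℕ} (hC : P C) :
    ∀ (d : ℕ) (t : Store), t.All P → ∀ (k : ℕ), (Store.ins d t k C).All P
  | 0, t, ht, k => by rw [ins_zero]; exact ht
  | d + 1, .nil, _, k => by
      rw [ins_succ_nil]
      cases Nat.ble k 1
      · cases Nat.beq (Nat.mod k 2) 0
        · exact ⟨Store.All_nil P, Or.inl rfl, Store.All.ins hC d .nil (Store.All_nil P) _⟩
        · exact ⟨Store.All.ins hC d .nil (Store.All_nil P) _, Or.inl rfl, Store.All_nil P⟩
      · exact ⟨Store.All_nil P, Or.inr hC, Store.All_nil P⟩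
  | d + 1, .node l v r, ⟨hl, hv, hr⟩, k => by
      rw [ins_succ_node]
      cases Nat.ble k 1
      · cases Nat.beq (Nat.mod k 2) 0
        · exact ⟨hl, hv, Store.All.ins hC d r hr _⟩
        · exact ⟨Store.All.ins hC d l hl _, hv, hr⟩
      · exact ⟨hl, Or.inr hC, hr⟩

/-- Inserting clauses whose masks satisfy `P` preserves the invariant. -/
theorem Store.All.insClauses {P : ℕ → Prop} (d : ℕ) :
    ∀ (L : List (List ℕ)) (t : Store) (i : ℕ), t.All P → (∀ C ∈ L, P (maskOf C)) →
      (Store.insClauses d t i L).All P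
  | [], t, i, ht, _ => by rw [insClauses_nil]; exact ht
  | C :: L, t, i, ht, hL => by
      rw [insClauses_cons]
      exact Store.All.insClauses d L _ _ (Store.All.ins (hL C (by simp)) d t ht i)
        fun C' hC' => hL C' (by simp [hC'])

/-- The store of a clause list all true under `σ` satisfies `Store.All (MaskSat σ)`. -/
theorem Store.All_ofClauses {σ : ℕ → Bool} (d : ℕ) {L : List (List ℕ)}
    (hL : ∀ C ∈ L, KRup.clauseTrue σ C = true) : (Store.ofClauses d L).All (MaskSat σ) :=
  Store.All.insClauses d L .nil 1 (Store.All_nil _) fun C hC => (maskSat_maskOf_iff σ C).2 (hL C hC)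

/-! ## Soundness of `rup` and `checkAll` -/

/-- Recording more falsified literals that are indeed false keeps `Cons`. -/
theorem cons_lor_swapPair {σ : ℕ → Bool} {E N F u : ℕ} (hE : E = evenMask N) (hF : Cons σ F)
    (hu : KRup.litTrue σ u = true) : Cons σ (Nat.lor F (swapPair E (2 ^ u))) := by
  intro l hl
  rw [show Nat.lor F (swapPair E (2 ^ u)) = F ||| swapPair E (2 ^ u) from rfl, Nat.testBit_lor,
    Bool.or_eq_true] at hl
  rcases hl with hl | hl
  · exact hF l hl
  · rw [eq_neg_of_testBit_swapPair hE hl, KRup.litTrue_neg, hu]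
    rfl

/-- SOUNDNESS OF `rup`: from a consistent falsified set, with every stored mask true under `σ`, the check
cannot succeed. -/
theorem rup_sound {σ : ℕ → Bool} {S : Store} {E N : ℕ} (hE : E = evenMask N)
    (hS : S.All (MaskSat σ)) :
    ∀ (f : ℕ) {F : ℕ}, Cons σ F → ∀ (hs : List ℕ), rup S E f F hs = true → False
  | 0, F, _, hs, h => by rw [rup_zero] at h; exact Bool.false_ne_true h
  | f + 1, F, _, [], h => by rw [rup_succ_nil] at h; exact Bool.false_ne_true h
  | f + 1, F, hF, hh :: hs, h => by
      rw [rup_succ_cons] at h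
      -- the hinted mask is stored (else the check fails)
      cases hD : Nat.beq (S.get hh) 0
      · rw [hD, cond_false] at h
        have hD' : S.get hh ≠ 0 := Nat.ne_of_beq_eq_false hD
        have hsat : MaskSat σ (S.get hh) := (Store.All.get hS hh).resolve_left hD'
        obtain ⟨l, hl, hlt⟩ := hsat
        -- the true literal `l` is not falsified, hence live
        have hFl : (Nat.testBit F l) = false := by
          cases hb : F.testBit l
          · rfl
          · have h' := hF l hb
            rw [hlt] at h'
            cases h'
        have hlive : (live (S.get hh) F).testBit l = true := by
          rw [testBit_live, hl, hFl]; rfl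
        cases hx : Nat.beq (live (S.get hh) F) 0
        · rw [hx, cond_false] at h
          have hx' : live (S.get hh) F ≠ 0 := Nat.ne_of_beq_eq_false hx
          cases hp : Nat.beq (Nat.land (live (S.get hh) F) (Nat.sub (live (S.get hh) F) 1)) 0
          · rw [hp, cond_false] at h
            exact Bool.false_ne_true h
          · rw [hp, cond_true] at h
            have hp' : live (S.get hh) F &&& (live (S.get hh) F - 1) = 0 := Nat.eq_of_beq_eq_true hp
            obtain ⟨u, hu⟩ := (Nat.and_sub_one_eq_zero_iff_isPowerOfTwo hx').1 hp'
            rw [hu, Nat.testBit_two_pow, decide_eq_true_eq] at hlive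
            subst hlive
            rw [hu] at h
            exact rup_sound hE hS f (cons_lor_swapPair hE hF hlt) hs h
        · -- "conflict" is impossible: bit `l` is live
          have hx0 : live (S.get hh) F = 0 := Nat.eq_of_beq_eq_true hx
          rw [hx0] at hlive
          simp at hlive
      · rw [hD, cond_true] at h
        exact Bool.false_ne_true h

/-- If a clause mask is not true under `σ`, falsifying all its literals is consistent. -/
theorem cons_of_not_maskSat {σ : ℕ → Bool} {C : ℕ} (h : ¬ MaskSat σ C) : Cons σ C := by
  intro l hl
  cases ht : KRup.litTrue σ l
  · rfl
  · exact absurd ⟨l, hl, ht⟩ h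

/-- SOUNDNESS OF `checkAll`: if every stored mask is true under `σ` and the steps check, then every step's
clause is true under `σ` AND the advanced store still satisfies the invariant (for chained segments). -/
theorem checkAll_sound {σ : ℕ → Bool} {E N : ℕ} (hE : E = evenMask N) (f d : ℕ) :
    ∀ (steps : List (List ℕ × List ℕ)) (S : Store) (i : ℕ), S.All (MaskSat σ) →
      checkAll f d E S i steps = true →
      (∀ st ∈ steps, MaskSat σ (maskOf st.1)) ∧ (advance d S i steps).All (MaskSat σ)
  | [], S, i, hS, _ => ⟨fun st hst => by simp at hst, by rw [advance_nil]; exact hS⟩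
  | st :: rest, S, i, hS, h => by
      rw [checkAll_cons, Bool.and_eq_true] at h
      have hC : MaskSat σ (maskOf st.1) := by
        by_contra hC
        exact rup_sound hE hS f (cons_of_not_maskSat hC) st.2 h.1
      have ih := checkAll_sound hE f d rest _ _ (Store.All.ins hC d S hS i) h.2
      refine ⟨fun st' hst' => ?_, by rw [advance_cons]; exact ih.2⟩
      simp only [List.mem_cons] at hst'
      rcases hst' with rfl | hst'
      · exact hC
      · exact ih.1 st' hst'

/-- CHAIN STEP: a checked segment carries the store invariant to the advanced store. -/
theorem all_advance_of_checkAll {σ : ℕ → Bool} {E N : ℕ} (hE : E = evenMask N) {f d : ℕ} {S : Store}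
    {i : ℕ} {steps : List (List ℕ × List ℕ)} (hS : S.All (MaskSat σ))
    (h : checkAll f d E S i steps = true) : (advance d S i steps).All (MaskSat σ) :=
  (checkAll_sound hE f d steps S i hS h).2

/-- `hasEmpty` finds a step with the empty clause. -/
theorem exists_nil_of_hasEmpty : ∀ {steps : List (List ℕ × List ℕ)}, hasEmpty steps = true →
    ∃ st ∈ steps, st.1 = []
  | [], h => by rw [hasEmpty_nil] at h; exact absurd h Bool.false_ne_true
  | st :: rest, h => by
      rw [hasEmpty_cons, Bool.or_eq_true] at h
      rcases h with h | h
      · refine ⟨st, by simp, ?_⟩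
        match hst : st.1 with
        | [] => rfl
        | _ :: _ => rw [hst] at h; exact absurd h Bool.false_ne_true
      · obtain ⟨st', hst', he⟩ := exists_nil_of_hasEmpty h
        exact ⟨st', by simp [hst'], he⟩

/-- CHAIN END: a checked segment containing the empty clause refutes `σ`. -/
theorem false_of_checkAll_of_hasEmpty {σ : ℕ → Bool} {E N : ℕ} (hE : E = evenMask N) {f d : ℕ}
    {S : Store} {i : ℕ} {steps : List (List ℕ × List ℕ)} (hS : S.All (MaskSat σ))
    (h : checkAll f d E S i steps = true) (he : hasEmpty steps = true) : False := by
  obtain ⟨st, hst, hnil⟩ := exists_nil_of_hasEmpty he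
  have := (checkAll_sound hE f d steps S i hS h).1 st hst
  rw [hnil, maskOf_nil] at this
  exact not_maskSat_zero σ this

/-- The store of the original clauses of a `CNF ℕ` satisfied by `σ` satisfies the invariant. -/
theorem all_ofClauses_cnf {σ : ℕ → Bool} (d : ℕ) {cnf : CNF Nat} (hsat : cnf.eval σ = true) :
    (Store.ofClauses d (KernelReplay.cnfToKRup cnf)).All (MaskSat σ) := by
  apply Store.All_ofClauses
  intro C hC
  simp only [KernelReplay.cnfToKRup, List.mem_map, Array.mem_toList_iff] at hC
  obtain ⟨c, hc, rfl⟩ := hC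
  rw [KernelReplay.clauseTrue_clauseToKRup]
  simp only [CNF.eval, Array.all_eq_true'] at hsat
  exact hsat c hc

/-- **Soundness of the fast kernel replay**: an accepted refutation makes the formula unsatisfiable
(`E` any `evenMask N` — emit the literal and prove the equation by `decide`). -/
theorem unsat_of_kernelRupFast {f d E N : ℕ} (hE : E = evenMask N) {cnf : CNF Nat}
    {steps : List (List ℕ × List ℕ)} (h : kernelRupFast f d E cnf steps = true) : cnf.Unsat := by
  unfold kernelRupFast at h
  rw [Bool.and_eq_true] at h
  intro σ
  by_contra hsat
  rw [Bool.not_eq_false] at hsat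
  exact false_of_checkAll_of_hasEmpty hE (all_ofClauses_cnf d hsat) h.1 h.2

/-! ## Control: a three-variable refutation (kernel `decide`) -/

/-- `evenMask 3 = 0b010101`. -/
theorem evenMask_three : 21 = evenMask 3 := by decide

/-- The CNF `x₀ ∧ (¬x₀ ∨ x₁) ∧ (¬x₁ ∨ x₂) ∧ ¬x₂` (ids 1–4) is refuted by the RUP steps
`5: x₁ [2,1]`, `6: x₂ [3,5]`, `7: ⊥ [4,6]` — accepted by the fast replay (`decide +kernel`). -/
theorem kernelRupFast_example :
    kernelRupFast 8 4 21
      (Std.Sat.CNF.mk #[[(0, true)], [(0, false), (1, true)], [(1, false), (2, true)], [(2, false)]])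
      [([2], [2, 1]), ([4], [3, 5]), ([], [4, 6])] = true := by
  decide +kernel

/-- … hence that CNF is unsatisfiable. -/
theorem example_unsat :
    (Std.Sat.CNF.mk #[[(0, true)], [(0, false), (1, true)], [(1, false), (2, true)], [(2, false)]]
      : CNF Nat).Unsat :=
  unsat_of_kernelRupFast evenMask_three kernelRupFast_example

end Summit.Ventures.QEC.Census.KRupFast
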